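import Summits.Schanuel.Schanuel.Theorems.RootDecomp1KLocalExponent02

/-!
# RootDecomp1KLocalExponent — lens 1, generation 54, NODE 14 «THE LOCAL EXPONENT: the named targets contactC at m₀ = 2 and highContactC at m₀ = 2, 3, 4 decided hypothesis-free» (RULE K-R42 (vii′) named-target clause, K-R44, K-R45) — continuation (RootDecomp1KLocalExponent03): §5 the theorem thinFibreAt_of_localAt, §5b presentation independence

(lens-1 g54 NODE 14 HOME kernel K = HOME/decomp-schanuel-lens-1/g54/LocalExponent.lean 0a24ac98…, 1537 l, 93 thm + 7 def, imports tree …RootDecomp1KHeightMachine05 ONLY (no Literature import); Probe / Ctrl0 / Ctrl + NODE-g54.md + SHA256SUMS; CLAIM L2617, crit EX-ANTE PRICE L2618 (ONE THEOREM ×1 under RULE K-R42 (vii′), NAMED-TARGET clause of L2599, iff CHECKLIST K-g54; RULE K-R45 pre-announced: local toolkit closure + frontier certificate, census instrument LIVENESS-v4), NODE L2621 / REQUEST L2622, census STAGING NOTE 4 L2623, critic VERDICT L2624: CLEARED — THEOREM ×1 under RULE K-R42 (vii′) (named-target clause), CHECKLIST K-g54 met; RULE K-R45 FIXED (local suppliers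 of record; LIVENESS-v4 = frontier certificate; unconditional part DecidedAt ∨ MachineDecidedAt ∨ LocalAt); PORT GO (verbatim; docstrings / the sanctioned privatisation only). Port by census-1 gen 22 as `RootDecomp1KLocalExponent01–06` (`--supports stmt-Schanuel-33364`; no census credit): 01 = §1 helpers + §2 the three local inputs (closed range of ℚ₂ in ℂ₂ `exists_pos_le_norm_ratCast_sub`; the 2-adic LIOUVILLE inequality at a RATIONAL centre `liouville_rat`; the nearest root with its OWN multiplicity); 02 = §3 the bounded region near a root + §4 the point (∞,∞) by its NEWTON SLOPES (`dTop`, `far_slope`, `slope_arith`, `FarClause`, `SlopeCond`, `farClause_of_slopeCond`, `farClause_of_empty`); 03 = §5 THE THEOREM **`thinFibreAt_of_localAt : LocalAt m₀ P → ThinFibreAt m₀ P`** (every m₀; `rootMult`, `RootCond`, `LocalAt`, engine `thinFibreAt_of_rootCond_farClause`, spelled-out `thinFibreAt_local`) + §5b presentation independence `localAt_iff`; 04 = §6 positioning (`localAt_of_thinThreshold_le`, `localAt_of_rootlessTop(_le)`, the tree theorems re-derived) + §7 the top Y⁵ − 1 (`padic_pow_five_eq_one`, `rootCond_two_pow_five_sub_one`)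 + §8 the NAMED TARGETS **`thinFibreAt_contact_two : ThinFibreAt 2 (xPolyP 2 contactC)`**, `thinFibreAt_highContact_three` / `_four` / `_highContact'`; 05 = §9 costume tests of the members + two refused tops; 06 = §10 **`thinFibreAt_highContact_two`** (outside the class: the critical segment v₂(r) = −N!/2 is EMPTY) + §11 bookkeeping ×0 (`LocalOffAt`, residual re-graded). PORT EDITS: the two generic one-liners `norm_natCast_le_one_Cp` / `norm_intCast_le_one_Cp` PRIVATISED (head dry-run dedup.foreign notes vs Summit.ABC… / Summit.BirchSwinnertonDyer… twins; file-local copies re-emitted where used); otherwise none on declarations (K fully documented; no set_option / cite-token); provenance doc blocks + continuation headers = K's own open-lines only; statements and proofs VERBATIM. Rung 0 — nothing here proves Schanuel, 33364, 33363, 31077 or ThinFibre 2; the class `LocalAt` and the named targets are HYPOTHESIS-FREE, §11 is conditional on PadicSubspace / HeightComparison.)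
-/

noncomputable section

namespace Summit.Schanuel.Schanuel.Theorems.RootDecomp1KLocalExponent

open Polynomial LiouvilleNumber
open scoped Nat
open Summit.Schanuel.Schanuel.Theorems.RootDecomp1KTwoBaseCell (psNumer partialSum_eq_psNumer_div coprime_psNumer)
open Summit.Schanuel.Schanuel.Theorems.RootDecomp1KRelLiouvilleCell (partialSum_two_strictMono)
open Summit.Schanuel.Schanuel.Theorems.RootDecomp1KDegreeLadder
open Summit.Schanuel.Schanuel.Theorems.RootDecomp1KXLinearCore
open Summit.Schanuel.Schanuel.Theorems.RootDecomp1KXLinear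
open Summit.Schanuel.Schanuel.Theorems.RootDecomp1KXLinearII
open Summit.Schanuel.Schanuel.Theorems.RootDecomp1KXTop
open Summit.Schanuel.Schanuel.Theorems.RootDecomp1KXAll
open Summit.Schanuel.Schanuel.Theorems.RootDecomp1KLevelFinite
open Summit.Schanuel.Schanuel.Theorems.RootDecomp1KSubspaceBranch
open Summit.Schanuel.Schanuel.Theorems.RootDecomp1KHeightMachine

/-- `‖z‖₂ ≤ 1` for integers. -/
private theorem norm_intCast_le_one_Cp (z : ℤ) : ‖(z : PadicAlgCl 2)‖ ≤ 1 := by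
  have h1 : (z : PadicAlgCl 2) = algebraMap ℚ_[2] (PadicAlgCl 2) (z : ℚ_[2]) := (map_intCast _ z).symm
  rw [h1, PadicAlgCl.norm_extends]
  exact Padic.norm_int_le_one z

/-! ## §5  THE THEOREM: local exponents decide the thin-fibre clause -/

/-- multiplicity of `β ∈ ℂ₂` as a root of `B ∈ ℤ[Y]`. -/
def rootMult (B : ℤ[X]) (β : PadicAlgCl 2) : ℕ := rootMultiplicity β (B.map (algebraMap ℤ (PadicAlgCl 2)))

/-- [datum def] the **ROOT CONDITION** at quality `m₀` on the top `x`-coefficient `B = c_k`: every root `β ∈ ℂ₂` of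
`B` is (i) OUTSIDE `ℚ₂`, or (ii) RATIONAL of multiplicity `μ_β ≤ m₀ − 1`, or (iii) of multiplicity `μ_β` with
`2μ_β + 1 ≤ m₀`. -/
def RootCond (m₀ : ℕ) (B : ℤ[X]) : Prop :=
  ∀ β : PadicAlgCl 2, aeval β B = 0 →
    (∀ y : ℚ_[2], algebraMap ℚ_[2] (PadicAlgCl 2) y ≠ β) ∨
    (∃ q : ℚ, (q : PadicAlgCl 2) = β ∧ rootMult B β + 1 ≤ m₀) ∨
    2 * rootMult B β + 1 ≤ m₀

/-- **THE ENGINE**: root condition on `c_k` + far clause ⟹ `ThinFibreAt m₀ (xPolyP k c)`. -/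
theorem thinFibreAt_of_rootCond_farClause (k : ℕ) (c : ℕ → ℤ[X]) (hB : c k ≠ 0) {m₀ : ℕ}
    (hR : RootCond m₀ (c k)) (hF : FarClause m₀ k c) : ThinFibreAt m₀ (xPolyP k c) := by
  classical
  obtain ⟨R, hRfar⟩ := hF
  intro C
  obtain ⟨Nfar, hNfar⟩ := hRfar C
  have hd1 : ∀ r : ℚ, (1 : ℝ) ≤ r.den := fun r => by exact_mod_cast Nat.succ_le_of_lt r.den_pos
  by_cases hd : 1 ≤ (c k).natDegree
  · obtain ⟨T, n, cc, N₁, hcc, hTroots, hn1, hnmult, hnear⟩ := near_root_own_mult k c hd R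
    -- (iii) Ridout data with the uniform exponent `μ' = max 1 ((m₀ − 1)/2)`
    set μ' : ℕ := max 1 ((m₀ - 1) / 2) with hμ'
    have hμ'1 : 1 ≤ μ' := le_max_left _ _
    obtain ⟨N₂, hN₂⟩ := dichotomy_arith_mult μ' cc C
    have hFin := ridout_window_pow (c k) hd C (4 * μ' + 1) (2 * μ') (by omega) (by omega)
    have hbad : (⋃ r ∈ {r : ℚ | |(r : ℝ)| ≤ C ∧ ∃ β : PadicAlgCl 2, aeval β (c k) = 0 ∧
        (r.den : ℝ) ^ (4 * μ' + 1) *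
          ‖((c k).leadingCoeff : PadicAlgCl 2) * ((r : PadicAlgCl 2) - β)‖ ^ (2 * μ') ≤ 1},
        {N : ℕ | bev (xPolyP k c) (partialSum 2 N) r = 0 ∧ ∃ x : ℝ, bev (xPolyP k c) x r ≠ 0}).Finite := by
      refine hFin.biUnion fun r _ => ?_
      by_cases hnd : ∃ x : ℝ, bev (xPolyP k c) x r ≠ 0
      · exact (levels_finite_of_nondeg _ r hnd).subset fun N hN => hN.1
      · exact Set.finite_empty.subset fun N hN => (hnd hN.2).elim
    obtain ⟨N₃, hN₃⟩ := hbad.bddAbove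
    -- (ii) the rational centres `q β`, Liouville constants, `(∞)`-arithmetic thresholds, own bad levels
    have hq0 : ∀ β : PadicAlgCl 2, ∃ q : ℚ, (∃ q' : ℚ, (q' : PadicAlgCl 2) = β) → (q : PadicAlgCl 2) = β := by
      intro β
      by_cases h : ∃ q' : ℚ, (q' : PadicAlgCl 2) = β
      · obtain ⟨q', hq'⟩ := h; exact ⟨q', fun _ => hq'⟩
      · exact ⟨0, fun h' => (h h').elim⟩
    choose q hq using hq0
    have hκ0 : ∀ β : PadicAlgCl 2, ∃ κ : ℝ, 0 < κ ∧ ∀ r : ℚ, r ≠ q β → |(r : ℝ)| ≤ C →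
        κ / r.den ≤ ‖(r : PadicAlgCl 2) - (q β : PadicAlgCl 2)‖ := fun β => liouville_rat (q β) C
    choose κ hκpos hκ using hκ0
    have hI : ∀ β : PadicAlgCl 2, ∃ N₄ : ℕ, ∀ N, N₄ ≤ N → ∀ d : ℕ, 1 ≤ d →
        (κ β ^ n β / cc) * 2 ^ N ! ≤ (d : ℝ) ^ n β → C * 2 ^ (N + 1)! < (d : ℝ) ^ ((n β + 1) * N) :=
      fun β => infinity_arith (κ β ^ n β / cc) C (div_pos (pow_pos (hκpos β) _) hcc) (n β)
    choose N₄ hN₄ using hI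
    have hbadQ : (⋃ β ∈ (T : Set (PadicAlgCl 2)),
        {N : ℕ | bev (xPolyP k c) (partialSum 2 N) (q β) = 0 ∧ ∃ x : ℝ, bev (xPolyP k c) x (q β) ≠ 0}).Finite := by
      refine T.finite_toSet.biUnion fun β _ => ?_
      by_cases hnd : ∃ x : ℝ, bev (xPolyP k c) x (q β) ≠ 0
      · exact (levels_finite_of_nondeg _ (q β) hnd).subset fun N hN => hN.1
      · exact Set.finite_empty.subset fun N hN => (hnd hN.2).elim
    obtain ⟨N₅, hN₅⟩ := hbadQ.bddAbove
    -- (i) the roots outside `ℚ₂`: distances `δ β` and thresholds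
    have hδ0 : ∀ β : PadicAlgCl 2, ∃ δ : ℝ, 0 < δ ∧ ((∀ y : ℚ_[2], algebraMap ℚ_[2] (PadicAlgCl 2) y ≠ β) →
        ∀ r : ℚ, δ ≤ ‖(r : PadicAlgCl 2) - β‖) := by
      intro β
      by_cases h : ∀ y : ℚ_[2], algebraMap ℚ_[2] (PadicAlgCl 2) y ≠ β
      · obtain ⟨δ, hδ, hδr⟩ := exists_pos_le_norm_ratCast_sub β h
        exact ⟨δ, hδ, fun _ => hδr⟩
      · exact ⟨1, one_pos, fun h' => (h h').elim⟩
    choose δ hδpos hδ using hδ0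
    have hNδ : ∀ β : PadicAlgCl 2, ∃ N₆ : ℕ, cc * (1 / 2 : ℝ) ^ N₆ < δ β ^ n β := by
      intro β
      obtain ⟨N₆, hN₆⟩ := exists_pow_lt_of_lt_one (div_pos (pow_pos (hδpos β) (n β)) hcc)
        (show (1 / 2 : ℝ) < 1 by norm_num)
      refine ⟨N₆, ?_⟩
      have := mul_lt_mul_of_pos_left hN₆ hcc
      rwa [mul_div_cancel₀ _ hcc.ne'] at this
    choose N₆ hN₆ using hNδ
    refine ⟨N₁ + Nfar + (N₃ + 1) + N₂ + (N₅ + 1) + T.sup N₄ + T.sup N₆, fun N hN r hr hP hnd => ?_⟩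
    by_cases hrR : ‖(r : PadicAlgCl 2)‖ ≤ R
    · obtain ⟨β, hβT, hrβ1, hx⟩ := hnear N (by omega) r hP hrR
      have hβroot : aeval β (c k) = 0 := hTroots β hβT
      have hnβ : n β = rootMult (c k) β := hnmult β
      rcases hR β hβroot with hi | ⟨q', hq'β, hii⟩ | hiii
      · -- (i) `β ∉ ℚ₂`: no rational comes within `δ β`; contradiction for `N ≥ N₆ β`
        exfalso
        have h1 : δ β ^ n β ≤ ‖(r : PadicAlgCl 2) - β‖ ^ n β :=
          pow_le_pow_left₀ (hδpos β).le (hδ β hi r) _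
        have hN6 : N₆ β ≤ N := le_trans (Finset.le_sup (f := N₆) hβT) (by omega)
        have h2 : (1 / 2 : ℝ) ^ N ! ≤ (1 / 2 : ℝ) ^ N₆ β :=
          pow_le_pow_of_le_one (by norm_num) (by norm_num) (hN6.trans (Nat.self_le_factorial N))
        have h3 : cc * (1 / 2 : ℝ) ^ N ! ≤ cc * (1 / 2 : ℝ) ^ N₆ β := mul_le_mul_of_nonneg_left h2 hcc.le
        linarith [hN₆ β]
      · -- (ii) rational centre `q β = q'`: the `2`-adic Liouville inequality
        have hqβ : (q β : PadicAlgCl 2) = β := hq β ⟨q', hq'β⟩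
        by_cases hrq : r = q β
        · -- the centre itself lies on finitely many levels
          exfalso
          have hmem : N ∈ ⋃ β ∈ (T : Set (PadicAlgCl 2)),
              {N : ℕ | bev (xPolyP k c) (partialSum 2 N) (q β) = 0 ∧ ∃ x : ℝ, bev (xPolyP k c) x (q β) ≠ 0} := by
            refine Set.mem_biUnion (Finset.mem_coe.mpr hβT) ?_
            rw [← hrq]; exact ⟨hP, hnd⟩
          have := hN₅ hmem
          omega
        · have hL : κ β / r.den ≤ ‖(r : PadicAlgCl 2) - β‖ := by
            have := hκ β r hrq hr; rwa [hqβ] at this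
          have hdenpos : (0 : ℝ) < r.den := by exact_mod_cast r.den_pos
          have h1 : (κ β / r.den) ^ n β ≤ cc * (1 / 2 : ℝ) ^ N ! :=
            (pow_le_pow_left₀ (div_pos (hκpos β) hdenpos).le hL _).trans hx
          have h2 : κ β ^ n β / cc * 2 ^ N ! ≤ (r.den : ℝ) ^ n β := by
            rw [div_pow] at h1
            have h2pos : (0 : ℝ) < 2 ^ N ! := by positivity
            have hdp : (0 : ℝ) < (r.den : ℝ) ^ n β := by positivity
            rw [div_le_iff₀ hdp] at h1
            rw [div_mul_eq_mul_div, div_le_iff₀ hcc]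
            have hhalf : (1 / 2 : ℝ) ^ N ! * 2 ^ N ! = 1 := by
              rw [div_pow, one_pow, div_mul_cancel₀ _ (ne_of_gt h2pos)]
            calc κ β ^ n β * 2 ^ N ! ≤ cc * (1 / 2 : ℝ) ^ N ! * (r.den : ℝ) ^ n β * 2 ^ N ! :=
                  mul_le_mul_of_nonneg_right h1 h2pos.le
              _ = (r.den : ℝ) ^ n β * cc := by
                  rw [show cc * (1 / 2 : ℝ) ^ N ! * (r.den : ℝ) ^ n β * 2 ^ N ! =
                    (r.den : ℝ) ^ n β * cc * ((1 / 2 : ℝ) ^ N ! * 2 ^ N !) by ring, hhalf, mul_one]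
          have hN4 : N₄ β ≤ N := le_trans (Finset.le_sup (f := N₄) hβT) (by omega)
          have h3 := hN₄ β N hN4 r.den (Nat.succ_le_of_lt r.den_pos) h2
          have hm : (n β + 1) * N ≤ m₀ * N := Nat.mul_le_mul_right _ (by rw [hnβ]; exact hii)
          exact h3.trans_le (pow_le_pow_right₀ (hd1 r) hm)
      · -- (iii) Ridout with exponent `2 + 1/(2μ')`, `μ' ≥ μ_β`
        have hn1β : 1 ≤ n β := hn1 β hβT
        have hnμ' : n β ≤ μ' := by
          rw [hnβ] at hn1β ⊢; rw [hμ']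
          refine le_trans ?_ (le_max_right _ _)
          omega
        have hℓle : ‖((c k).leadingCoeff : PadicAlgCl 2)‖ ≤ 1 := norm_intCast_le_one_Cp _
        have hxμ : ‖((c k).leadingCoeff : PadicAlgCl 2) * ((r : PadicAlgCl 2) - β)‖ ^ μ' ≤
            cc * (1 / 2 : ℝ) ^ N ! := by
          rw [norm_mul, mul_pow]
          calc ‖((c k).leadingCoeff : PadicAlgCl 2)‖ ^ μ' * ‖(r : PadicAlgCl 2) - β‖ ^ μ'
              ≤ 1 * ‖(r : PadicAlgCl 2) - β‖ ^ n β := by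
                refine mul_le_mul (pow_le_one₀ (norm_nonneg _) hℓle) ?_ (by positivity) zero_le_one
                exact pow_le_pow_of_le_one (norm_nonneg _) hrβ1.le hnμ'
            _ ≤ cc * (1 / 2 : ℝ) ^ N ! := by rw [one_mul]; exact hx
        have hnot : ¬ ((r.den : ℝ) ^ (4 * μ' + 1) *
            ‖((c k).leadingCoeff : PadicAlgCl 2) * ((r : PadicAlgCl 2) - β)‖ ^ (2 * μ') ≤ 1) := by
          intro hineq
          have hmem : N ∈ ⋃ r ∈ {r : ℚ | |(r : ℝ)| ≤ C ∧ ∃ β : PadicAlgCl 2, aeval β (c k) = 0 ∧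
              (r.den : ℝ) ^ (4 * μ' + 1) *
                ‖((c k).leadingCoeff : PadicAlgCl 2) * ((r : PadicAlgCl 2) - β)‖ ^ (2 * μ') ≤ 1},
              {N : ℕ | bev (xPolyP k c) (partialSum 2 N) r = 0 ∧ ∃ x : ℝ, bev (xPolyP k c) x r ≠ 0} :=
            Set.mem_biUnion (x := r) ⟨hr, β, hβroot, hineq⟩ ⟨hP, hnd⟩
          have := hN₃ hmem
          omega
        have h3 := hN₂ N (by omega) r.den _ (Nat.succ_le_of_lt r.den_pos) (norm_nonneg _) hxμ hnot
        have hm : (2 * μ' + 1) * N ≤ m₀ * N := by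
          refine Nat.mul_le_mul_right _ ?_
          rw [hnβ] at hn1β
          rw [hμ']
          rcases le_or_gt ((m₀ - 1) / 2) 1 with hle | hlt
          · rw [max_eq_left hle]; omega
          · rw [max_eq_right hlt.le]; omega
        exact h3.trans_le (pow_le_pow_right₀ (hd1 r) hm)
    · push Not at hrR
      exact hNfar N (by omega) r hP hrR
  · -- constant non-zero top coefficient: NO roots; the bounded region carries no points for large `N`
    have hd0 : (c k).natDegree = 0 := by omega
    have hℓpos : 0 < ‖((c k).leadingCoeff : PadicAlgCl 2)‖ := by
      rw [norm_pos_iff]; exact_mod_cast leadingCoeff_ne_zero.mpr hB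
    set M : ℝ := max 1 R with hMdef
    have hMpos : 0 < M := lt_of_lt_of_le one_pos (le_max_left _ _)
    obtain ⟨N₁, hN₁⟩ := exists_pow_lt_of_lt_one (div_pos hℓpos (pow_pos hMpos (dTop k c)))
      (show (1 / 2 : ℝ) < 1 by norm_num)
    refine ⟨N₁ + Nfar + 3, fun N hN r hr hP hnd => ?_⟩
    by_cases hrR : ‖(r : PadicAlgCl 2)‖ ≤ R
    · exfalso
      have hdom := top_coeff_small' k c (show 3 ≤ N by omega) r hP
      obtain ⟨a, ha⟩ := natDegree_eq_zero.mp hd0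
      have hC0 : aeval (r : PadicAlgCl 2) (c k) = ((c k).leadingCoeff : PadicAlgCl 2) := by
        rw [← ha, aeval_C, leadingCoeff_C]
        exact eq_intCast (algebraMap ℤ (PadicAlgCl 2)) a
      rw [hC0] at hdom
      have hmax : max 1 ‖(r : PadicAlgCl 2)‖ ≤ M := max_le (le_max_left _ _) (hrR.trans (le_max_right _ _))
      have h1 : ‖((c k).leadingCoeff : PadicAlgCl 2)‖ ≤ (1 / 2 : ℝ) ^ N ! * M ^ dTop k c :=
        hdom.trans (mul_le_mul_of_nonneg_left
          (pow_le_pow_left₀ (le_trans zero_le_one (le_max_left _ _)) hmax _) (by positivity))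
      have h2 : (1 / 2 : ℝ) ^ N ! ≤ (1 / 2 : ℝ) ^ N₁ :=
        pow_le_pow_of_le_one (by norm_num) (by norm_num) (le_trans (by omega) (Nat.self_le_factorial N))
      have h3 : ‖((c k).leadingCoeff : PadicAlgCl 2)‖ < ‖((c k).leadingCoeff : PadicAlgCl 2)‖ / M ^ dTop k c *
          M ^ dTop k c := by
        calc ‖((c k).leadingCoeff : PadicAlgCl 2)‖ ≤ (1 / 2 : ℝ) ^ N ! * M ^ dTop k c := h1
          _ ≤ (1 / 2 : ℝ) ^ N₁ * M ^ dTop k c := mul_le_mul_of_nonneg_right h2 (by positivity)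
          _ < ‖((c k).leadingCoeff : PadicAlgCl 2)‖ / M ^ dTop k c * M ^ dTop k c :=
              mul_lt_mul_of_pos_right hN₁ (pow_pos hMpos _)
      rw [div_mul_cancel₀ _ (pow_pos hMpos _).ne'] at h3
      exact lt_irrefl _ h3
    · push Not at hrR
      exact hNfar N (by omega) r hP hrR

/-- [class] definition (typed curve class, census convention): **the class decided by LOCAL EXPONENTS at quality
`m₀`** — `P = Σ_{j ≤ k} x^j c_j(Y)` (any `x`-degree `k`, `c_k ≠ 0`) whose top `x`-coefficient satisfies the ROOT
CONDITION at `m₀` and whose Newton slopes at `(∞,∞)` exceed `1/m₀`. -/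
def LocalAt (m₀ : ℕ) (P : ℤ[X][X]) : Prop :=
  ∃ (k : ℕ) (c : ℕ → ℤ[X]), c k ≠ 0 ∧ P = xPolyP k c ∧ RootCond m₀ (c k) ∧ SlopeCond m₀ k c

/-- **NODE 14 — THE THEOREM: `LocalAt m₀ P → ThinFibreAt m₀ P`, for every `m₀`, HYPOTHESIS-FREE.** -/
theorem thinFibreAt_of_localAt {m₀ : ℕ} {P : ℤ[X][X]} (h : LocalAt m₀ P) : ThinFibreAt m₀ P := by
  obtain ⟨k, c, hB, rfl, hR, hS⟩ := h
  exact thinFibreAt_of_rootCond_farClause k c hB hR (farClause_of_slopeCond k c hB hS)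

/-- the parametric form with the binders spelled out (the CLAIM's (R) and (S), L2617). -/
theorem thinFibreAt_local (k : ℕ) (c : ℕ → ℤ[X]) (hB : c k ≠ 0) {m₀ : ℕ}
    (hroot : ∀ β : PadicAlgCl 2, aeval β (c k) = 0 →
      (∀ y : ℚ_[2], algebraMap ℚ_[2] (PadicAlgCl 2) y ≠ β) ∨
      (∃ q : ℚ, (q : PadicAlgCl 2) = β ∧ rootMultiplicity β ((c k).map (algebraMap ℤ (PadicAlgCl 2))) + 1 ≤ m₀) ∨
      2 * rootMultiplicity β ((c k).map (algebraMap ℤ (PadicAlgCl 2))) + 1 ≤ m₀)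
    (hslope : ∀ j, j < k → (c k).natDegree < (c j).natDegree → (c j).natDegree - (c k).natDegree < m₀ * (k - j)) :
    ThinFibreAt m₀ (xPolyP k c) :=
  thinFibreAt_of_localAt ⟨k, c, hB, rfl, hroot, hslope⟩

/-- the root condition is monotone in `m₀`. -/
theorem rootCond_mono {m₀ m₁ : ℕ} (h : m₀ ≤ m₁) {B : ℤ[X]} (hR : RootCond m₀ B) : RootCond m₁ B := by
  intro β hβ
  rcases hR β hβ with hi | ⟨q, hq, hii⟩ | hiii
  · exact Or.inl hi
  · exact Or.inr (Or.inl ⟨q, hq, hii.trans h⟩)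
  · exact Or.inr (Or.inr (hiii.trans h))

/-- the slope condition is monotone in `m₀`. -/
theorem slopeCond_mono {m₀ m₁ : ℕ} (h : m₀ ≤ m₁) {k : ℕ} {c : ℕ → ℤ[X]} (hS : SlopeCond m₀ k c) :
    SlopeCond m₁ k c :=
  fun j hj hdj => (hS j hj hdj).trans_le (Nat.mul_le_mul_right _ h)

/-- the class increases with `m₀`. -/
theorem localAt_mono {m₀ m₁ : ℕ} (h : m₀ ≤ m₁) {P : ℤ[X][X]} (hP : LocalAt m₀ P) : LocalAt m₁ P := by
  obtain ⟨k, c, hB, hPe, hR, hS⟩ := hP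
  exact ⟨k, c, hB, hPe, rootCond_mono h hR, slopeCond_mono h hS⟩

/-! ## §5b  PRESENTATION INDEPENDENCE: `LocalAt m₀ P` read off the intrinsic `topX P`, `xdeg P`, `xCoeff P` -/

/-- `xPolyP k c ≠ 0` when `c k ≠ 0`. -/
theorem xPolyP_ne_zero {k : ℕ} {c : ℕ → ℤ[X]} (hB : c k ≠ 0) : xPolyP k c ≠ 0 := by
  intro h0
  apply hB
  ext i
  have h := coeff_coeff_xPolyP k c i k
  rw [h0, coeff_zero, coeff_zero, if_pos (Finset.self_mem_range_succ k)] at h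
  rw [coeff_zero]; exact h.symm

/-- two presentations `xPolyP k c = xPolyP k' c'` with `c k ≠ 0`: the second top coefficient is `c k` or `0`. -/
theorem top_cases_of_eq (k : ℕ) (c : ℕ → ℤ[X]) (hB : c k ≠ 0) (k' : ℕ) (c' : ℕ → ℤ[X])
    (h : xPolyP k c = xPolyP k' c') : c' k' = c k ∨ c' k' = 0 := by
  have hk' : xCoeff (xPolyP k c) k' = c' k' := by rw [h, xCoeff_xPolyP, if_pos le_rfl]
  have hk : xCoeff (xPolyP k' c') k = c k := by rw [← h, xCoeff_xPolyP, if_pos le_rfl]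
  rw [xCoeff_xPolyP] at hk' hk
  rcases lt_trichotomy k' k with hlt | rfl | hgt
  · exfalso; rw [if_neg (not_le.mpr hlt)] at hk; exact hB hk.symm
  · left; rw [if_pos le_rfl] at hk'; exact hk'.symm
  · right; rw [if_neg (not_le.mpr hgt)] at hk'; exact hk'.symm

/-- **`LocalAt` does not depend on the presentation**: it is the conjunction of `P ≠ 0`, the ROOT CONDITION on
the intrinsic top `x`-coefficient `topX P` and the SLOPE CONDITION on the intrinsic `x`-coefficients `xCoeff P j`,
`j ≤ xdeg P` (tree `RootDecomp1KXAll.topX / xdeg / xCoeff`). -/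
theorem localAt_iff {m₀ : ℕ} {P : ℤ[X][X]} :
    LocalAt m₀ P ↔ P ≠ 0 ∧ RootCond m₀ (topX P) ∧ SlopeCond m₀ (xdeg P) (xCoeff P) := by
  constructor
  · rintro ⟨k, c, hB, rfl, hR, hS⟩
    refine ⟨xPolyP_ne_zero hB, by rw [topX_xPolyP k c hB]; exact hR, ?_⟩
    rw [xdeg_xPolyP k c hB]
    intro j hj hdj
    have hj' : xCoeff (xPolyP k c) j = c j := by rw [xCoeff_xPolyP, if_pos hj.le]
    have hk' : xCoeff (xPolyP k c) k = c k := by rw [xCoeff_xPolyP, if_pos le_rfl]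
    rw [hj', hk'] at hdj ⊢
    exact hS j hj hdj
  · rintro ⟨hP, hR, hS⟩
    exact ⟨xdeg P, xCoeff P, topX_ne_zero hP, (xPolyP_xCoeff P).symm, hR, hS⟩

/-- in particular the root condition of a member is a condition on `topX P`. -/
theorem rootCond_topX_of_localAt {m₀ : ℕ} {P : ℤ[X][X]} (h : LocalAt m₀ P) : RootCond m₀ (topX P) :=
  (localAt_iff.mp h).2.1

/-- … and the slope condition is a condition on the `xCoeff P j`. -/
theorem slopeCond_xCoeff_of_localAt {m₀ : ℕ} {P : ℤ[X][X]} (h : LocalAt m₀ P) : SlopeCond m₀ (xdeg P) (xCoeff P) :=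
  (localAt_iff.mp h).2.2

/-- `ℚ₂ → ℂ₂` commutes with evaluation of an integer polynomial. -/
theorem algebraMap_aeval_padic (y : ℚ_[2]) (B : ℤ[X]) :
    algebraMap ℚ_[2] (PadicAlgCl 2) (aeval y B) = aeval (algebraMap ℚ_[2] (PadicAlgCl 2) y) B := by
  rw [aeval_def, aeval_def, hom_eval₂]
  exact congrArg (fun f : ℤ →+* PadicAlgCl 2 => eval₂ f (algebraMap ℚ_[2] (PadicAlgCl 2) y) B) (RingHom.ext_int _ _)

end Summit.Schanuel.Schanuel.Theorems.RootDecomp1KLocalExponent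

end
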